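import Mathlib
import Summits.PneNP.PneNP.Theses.OneSlice
import Summits.PneNP.PneNP.Theorems.OneSliceSliceTargetSplit
import Literature.Computability.Complexity.MajorityVoteWeighted

/-!
# Route OneSlice, crux `MonotoneContinuation` (stmt-PneNP-18471), line `Sketch_ideator1_r1` (ProfileLine) — stub derandomize

DERANDOMIZED MAJORITY VOTE. Let `w` be a probability vector on the edge cube of `K_n` ("restrictions" `ρ`), `g ρ`
Boolean tests, `U(y) := Σ_ρ w(ρ)·𝟙[g ρ y]` their `w`-average and `G` any Boolean function. For every `t ≥ 1` some
`t` FIXED restrictions `ρ_1, …, ρ_t` have their majority vote `y ↦ [t < 2·#{a : g (ρ_a) y}]` within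
`4/t + 5‖U − 𝟙[G]‖` of `U` in `L¹(G(n,p))` (`l1 n p`). Proof (the probabilistic method; no circuits): draw
`ρs ∼ w^{⊗t}` (product weight `Π_a w(ρs a)` on `Fin t → cube`, total mass `1` by `Fintype.sum_pow`) and bound the
AVERAGE `L¹` error; a minimiser of the error is at most its average (`derandomize_exists_le_avg`). After swapping
the two finite sums the average is `Σ_y gnpWeight(y)·E_ρs|Maj_ρs(y) − U(y)|`, and for a FIXED `y` (`u := U(y) ∈ [0,1]`,
`b := G y`): always `E|Maj − u| ≤ 1`; if `u ≥ 4/5` the vote sequences WITHOUT a strict majority of accepting votes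
have product weight `≤ 1/(4t·(3/10)²) ≤ 3/t` (the weighted Chebyshev majority bound
`Literature.Computability.Complexity.sum_majority_fail_mul_le`, margin `3/10`), whence `E|Maj − u| ≤ 3/t + (1 − u)`
(`derandomize_point_heavy`); symmetrically `E|Maj − u| ≤ 3/t + u` if `u ≤ 1/5` (`derandomize_point_light`, the
rejecting votes are the good outcomes). In all cases `E|Maj − u| ≤ 3/t + 5|u − 𝟙[b]|` (`derandomize_point`), and
integrating against `gnpWeight n p` (total mass `1`, `sum_gnpWeight`) gives `3/t + 5‖U − 𝟙[G]‖ ≤ 4/t + 5‖U − 𝟙[G]‖`.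
-/

set_option linter.dupNamespace false -- `Summit.PneNP.PneNP.…`: summit = sub-problem (D-0017)

namespace Summit.PneNP.PneNP.Theorems.MonotoneContinuation

open Literature.Computability.Complexity hiding supp mem_supp
open Finset hiding slice
open Filter hiding mem_sdiff
open Classical
open Summit.PneNP.PneNP.Theorems (binomialWeight_tail_le binomialWeight_sum_range binomialWeight_nonneg
  binomialWeight_variance card_slice)
open Summit.PneNP.PneNP.Theorems.ConstantBand.Negative (Edge thr Central slice)
open Summit.PneNP.PneNP.Theorems.SingleThreshold.Negative (pc)
open Summit.PneNP.PneNP.Theorems.SliceACZero.Negative (supp mem_supp card_supp supp_injective supp_indicator)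
open Summit.PneNP.PneNP.Theorems.SliceTargetSplit (Comp nbhd mem_nbhd transport ind l1 nbhdCard card_nbhd
  card_nbhd_of_le card_nbhd_of_ge choose_mul_nbhdCard nbhdCard_pos sum_slice_sum_nbhd sum_slice_sum_nbhd_left
  supp_subset_of_comp_of_le comp_iff_supp comp_comm ofSet supp_ofSet ofSet_supp edgeCount_ofSet ind_nonneg
  ind_le_one abs_ind_sub_ind l1_triangle l1_comm l1_nonneg transport_nonneg transport_sub)

noncomputable section

variable {n : ℕ}

/-! ### Averaging and the Chebyshev step -/

/-- **Averaging (the probabilistic method).** Under a probability vector `P` on a finite type some point has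
`X`-value at most the `P`-average of `X` (a minimiser of `X` does). [folklore] -/
theorem derandomize_exists_le_avg {β : Type*} [Fintype β] (P X : β → ℝ) (hP : ∀ b, 0 ≤ P b)
    (hP1 : ∑ b, P b = 1) : ∃ b, X b ≤ ∑ b, P b * X b := by
  have hne : (univ : Finset β).Nonempty := nonempty_of_sum_ne_zero (by rw [hP1]; exact one_ne_zero)
  obtain ⟨b₀, -, hb₀⟩ := exists_min_image univ X hne
  refine ⟨b₀, ?_⟩
  calc X b₀ = ∑ b, P b * X b₀ := by rw [← sum_mul, hP1, one_mul]
    _ ≤ ∑ b, P b * X b := sum_le_sum fun b _ => mul_le_mul_of_nonneg_left (hb₀ b (mem_univ b)) (hP b)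

/-- **Chebyshev step.** If the good outcomes carry `w`-weight at least `4/5` (`w` a probability vector on a finite
outcome type), the `w^{⊗t}`-weight of the sequences of `t ≥ 1` outcomes WITHOUT a strict majority of good entries
is at most `3/t` (`sum_majority_fail_mul_le` with margin `η = 3/10`: `1/(4t·9/100) = 25/(9t) ≤ 3/t`). [folklore] -/
theorem derandomize_fail_le {α : Type*} [Fintype α] (w : α → ℝ) (hw : ∀ a, 0 ≤ w a) (hw1 : ∑ a, w a = 1)
    (good : α → Prop) [DecidablePred good] {t : ℕ} (ht : 0 < t)
    (hgood : 4 / 5 ≤ ∑ a ∈ univ.filter good, w a) :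
    ∑ ω ∈ univ.filter (fun ω : Fin t → α => 2 * #(univ.filter fun i => good (ω i)) ≤ t), ∏ i, w (ω i) ≤
      3 / t := by
  have h := sum_majority_fail_mul_le w hw hw1 good ht (show (0 : ℝ) < 3 / 10 by norm_num) (by linarith)
  have ht' : (0 : ℝ) < t := by exact_mod_cast ht
  rw [le_div_iff₀ ht']
  linarith

/-! ### One point of the cube -/

/-- `Σ_ω (Π_i w(ω i))·(𝟙[c ω] + r) = w^{⊗t}(c) + r` for a probability vector `w`. [folklore] -/
theorem derandomize_sum_mul_ite_add {α : Type*} [Fintype α] (w : α → ℝ) (hw1 : ∑ a, w a = 1) (t : ℕ)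
    (c : (Fin t → α) → Prop) [DecidablePred c] (r : ℝ) :
    ∑ ω : Fin t → α, (∏ i, w (ω i)) * ((if c ω then (1 : ℝ) else 0) + r) =
      (∑ ω ∈ univ.filter c, ∏ i, w (ω i)) + r := by
  have hPw1 : ∑ ω : Fin t → α, ∏ i, w (ω i) = 1 := by rw [← Fintype.sum_pow, hw1, one_pow]
  rw [sum_filter]
  calc ∑ ω : Fin t → α, (∏ i, w (ω i)) * ((if c ω then (1 : ℝ) else 0) + r)
        = ∑ ω : Fin t → α, ((if c ω then ∏ i, w (ω i) else 0) + (∏ i, w (ω i)) * r) :=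
          sum_congr rfl fun ω _ => by split_ifs <;> ring
    _ = (∑ ω : Fin t → α, if c ω then ∏ i, w (ω i) else 0) + (∑ ω : Fin t → α, ∏ i, w (ω i)) * r := by
          rw [sum_add_distrib, sum_mul]
    _ = (∑ ω : Fin t → α, if c ω then ∏ i, w (ω i) else 0) + r := by rw [hPw1, one_mul]

/-- **One point, acceptance-heavy.** If the accepting outcomes have weight `u ≥ 4/5`, the `w^{⊗t}`-average of
`|Maj − u|` is at most `3/t + (1 − u)`: pointwise `|Maj − u| ≤ 𝟙[no strict accepting majority] + (1 − u)`, and the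
failure event has weight `≤ 3/t` (`derandomize_fail_le`). [folklore] -/
theorem derandomize_point_heavy {α : Type*} [Fintype α] (w : α → ℝ) (hw : ∀ a, 0 ≤ w a) (hw1 : ∑ a, w a = 1)
    (P : α → Bool) {t : ℕ} (ht : 0 < t) {u : ℝ} (hu : u = ∑ a ∈ univ.filter (fun a => P a = true), w a)
    (hu1 : u ≤ 1) (h45 : 4 / 5 ≤ u) :
    ∑ ω : Fin t → α, (∏ i, w (ω i)) *
        |(if t < 2 * #(univ.filter fun i : Fin t => P (ω i) = true) then (1 : ℝ) else 0) - u| ≤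
      3 / t + (1 - u) := by
  have hPw0 : ∀ ω : Fin t → α, 0 ≤ ∏ i, w (ω i) := fun ω => prod_nonneg fun i _ => hw (ω i)
  have hfail := derandomize_fail_le w hw hw1 (fun a => P a = true) ht (by rw [← hu]; exact h45)
  have hu0 : 0 ≤ u := by linarith
  -- pointwise: `|Maj − u| ≤ 𝟙[no strict accepting majority] + (1 − u)`
  have hpt : ∀ ω : Fin t → α,
      |(if t < 2 * #(univ.filter fun i : Fin t => P (ω i) = true) then (1 : ℝ) else 0) - u| ≤
        (if 2 * #(univ.filter fun i : Fin t => P (ω i) = true) ≤ t then (1 : ℝ) else 0) + (1 - u) := by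
    intro ω
    by_cases hlt : t < 2 * #(univ.filter fun i : Fin t => P (ω i) = true)
    · rw [if_pos hlt, if_neg (not_le.2 hlt), abs_of_nonneg (by linarith)]
      linarith
    · rw [if_neg hlt, if_pos (not_lt.1 hlt), zero_sub, abs_neg, abs_of_nonneg hu0]
      linarith
  calc _ ≤ ∑ ω : Fin t → α, (∏ i, w (ω i)) *
          ((if 2 * #(univ.filter fun i : Fin t => P (ω i) = true) ≤ t then (1 : ℝ) else 0) + (1 - u)) :=
        sum_le_sum fun ω _ => mul_le_mul_of_nonneg_left (hpt ω) (hPw0 ω)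
    _ = (∑ ω ∈ univ.filter (fun ω : Fin t → α => 2 * #(univ.filter fun i => P (ω i) = true) ≤ t),
          ∏ i, w (ω i)) + (1 - u) :=
        derandomize_sum_mul_ite_add w hw1 t _ (1 - u)
    _ ≤ 3 / t + (1 - u) := by linarith [hfail]

/-- **One point, acceptance-light.** If the accepting outcomes have weight `u ≤ 1/5`, the `w^{⊗t}`-average of
`|Maj − u|` is at most `3/t + u`: pointwise `|Maj − u| ≤ 𝟙[no strict rejecting majority] + u` (a strict accepting
majority leaves no rejecting majority), and that event has weight `≤ 3/t` (`derandomize_fail_le` for the rejecting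
outcomes, of weight `1 − u ≥ 4/5`). [folklore] -/
theorem derandomize_point_light {α : Type*} [Fintype α] (w : α → ℝ) (hw : ∀ a, 0 ≤ w a) (hw1 : ∑ a, w a = 1)
    (P : α → Bool) {t : ℕ} (ht : 0 < t) {u : ℝ}
    (hu : 1 - u = ∑ a ∈ univ.filter (fun a => ¬ (P a = true)), w a) (hu0 : 0 ≤ u) (h15 : u ≤ 1 / 5) :
    ∑ ω : Fin t → α, (∏ i, w (ω i)) *
        |(if t < 2 * #(univ.filter fun i : Fin t => P (ω i) = true) then (1 : ℝ) else 0) - u| ≤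
      3 / t + u := by
  have hPw0 : ∀ ω : Fin t → α, 0 ≤ ∏ i, w (ω i) := fun ω => prod_nonneg fun i _ => hw (ω i)
  have hfail := derandomize_fail_le w hw hw1 (fun a => ¬ (P a = true)) ht (by rw [← hu]; linarith)
  -- pointwise: `|Maj − u| ≤ 𝟙[no strict rejecting majority] + u`
  have hpt : ∀ ω : Fin t → α,
      |(if t < 2 * #(univ.filter fun i : Fin t => P (ω i) = true) then (1 : ℝ) else 0) - u| ≤
        (if 2 * #(univ.filter fun i : Fin t => ¬ (P (ω i) = true)) ≤ t then (1 : ℝ) else 0) + u := by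
    intro ω
    have hcard := card_filter_add_card_filter_not (s := (univ : Finset (Fin t))) (fun i : Fin t => P (ω i) = true)
    rw [card_univ, Fintype.card_fin] at hcard
    by_cases hlt : t < 2 * #(univ.filter fun i : Fin t => P (ω i) = true)
    · have hle : 2 * #(univ.filter fun i : Fin t => ¬ (P (ω i) = true)) ≤ t := by omega
      rw [if_pos hlt, if_pos hle, abs_of_nonneg (by linarith)]
      linarith
    · have h0 : (0 : ℝ) ≤ (if 2 * #(univ.filter fun i : Fin t => ¬ (P (ω i) = true)) ≤ t then (1 : ℝ) else 0) := by
        split_ifs <;> norm_num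
      rw [if_neg hlt, zero_sub, abs_neg, abs_of_nonneg hu0]
      linarith
  calc _ ≤ ∑ ω : Fin t → α, (∏ i, w (ω i)) *
          ((if 2 * #(univ.filter fun i : Fin t => ¬ (P (ω i) = true)) ≤ t then (1 : ℝ) else 0) + u) :=
        sum_le_sum fun ω _ => mul_le_mul_of_nonneg_left (hpt ω) (hPw0 ω)
    _ = (∑ ω ∈ univ.filter (fun ω : Fin t → α => 2 * #(univ.filter fun i => ¬ (P (ω i) = true)) ≤ t),
          ∏ i, w (ω i)) + u :=
        derandomize_sum_mul_ite_add w hw1 t _ u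
    _ ≤ 3 / t + u := by linarith [hfail]

/-- `𝟙[decide c] = 𝟙[c]` as real indicators. [folklore] -/
theorem derandomize_ite_decide (c : Prop) [Decidable c] :
    (if decide c = true then (1 : ℝ) else 0) = if c then 1 else 0 := by
  by_cases h : c <;> simp [h]

/-- **One point.** For a probability vector `w` on a finite outcome type, a Boolean test `P` with accepting weight
`u := Σ_a w(a)𝟙[P a]`, `t ≥ 1` and any `b : Bool`, the `w^{⊗t}`-average over `ω : Fin t → α` of
`|𝟙[t < 2·#{i : P (ω i)}] − u|` is at most `3/t + 5|u − 𝟙[b]|` (trivially `≤ 1 ≤ 5|u − 𝟙[b]|` unless `u` is within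
`1/5` of `𝟙[b]`, and then `derandomize_point_heavy` / `derandomize_point_light`). [folklore] -/
theorem derandomize_point {α : Type*} [Fintype α] (w : α → ℝ) (hw : ∀ a, 0 ≤ w a) (hw1 : ∑ a, w a = 1)
    (P : α → Bool) {t : ℕ} (ht : 0 < t) (b : Bool) :
    ∑ ω : Fin t → α, (∏ i, w (ω i)) *
        |(if decide (t < 2 * #(univ.filter fun i : Fin t => P (ω i) = true)) = true then (1 : ℝ) else 0) -
          ∑ a, w a * (if P a = true then (1 : ℝ) else 0)| ≤
      3 / t + 5 * |(∑ a, w a * (if P a = true then (1 : ℝ) else 0)) - (if b = true then (1 : ℝ) else 0)| := by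
  simp_rw [derandomize_ite_decide]
  set u := ∑ a, w a * (if P a = true then (1 : ℝ) else 0) with hu_def
  have hu : u = ∑ a ∈ univ.filter (fun a => P a = true), w a := by
    rw [hu_def, sum_filter]
    exact sum_congr rfl fun a _ => mul_boole _ _
  have hu' : 1 - u = ∑ a ∈ univ.filter (fun a => ¬ (P a = true)), w a := by
    rw [sub_eq_iff_eq_add', hu, sum_filter_add_sum_filter_not, hw1]
  have hu0 : 0 ≤ u := hu ▸ sum_nonneg fun a _ => hw a
  have hu1 : u ≤ 1 := by
    have : 0 ≤ 1 - u := hu' ▸ sum_nonneg fun a _ => hw a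
    linarith
  have hPw0 : ∀ ω : Fin t → α, 0 ≤ ∏ i, w (ω i) := fun ω => prod_nonneg fun i _ => hw (ω i)
  have hPw1 : ∑ ω : Fin t → α, ∏ i, w (ω i) = 1 := by rw [← Fintype.sum_pow, hw1, one_pow]
  -- the trivial bound `E|Maj − u| ≤ 1`
  have hint : ∀ ω : Fin t → α,
      |(if t < 2 * #(univ.filter fun i : Fin t => P (ω i) = true) then (1 : ℝ) else 0) - u| ≤ 1 := by
    intro ω
    rw [abs_le]
    split_ifs <;> constructor <;> linarith
  have htriv : ∑ ω : Fin t → α, (∏ i, w (ω i)) *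
      |(if t < 2 * #(univ.filter fun i : Fin t => P (ω i) = true) then (1 : ℝ) else 0) - u| ≤ 1 := by
    calc _ ≤ ∑ ω : Fin t → α, (∏ i, w (ω i)) * 1 :=
          sum_le_sum fun ω _ => mul_le_mul_of_nonneg_left (hint ω) (hPw0 ω)
      _ = 1 := by rw [← sum_mul, hPw1, one_mul]
  have ht0 : (0 : ℝ) ≤ 3 / t := by positivity
  cases b with
  | true =>
    rw [if_pos rfl, abs_sub_comm u 1, abs_of_nonneg (by linarith)]
    by_cases h45 : 4 / 5 ≤ u
    · have := derandomize_point_heavy w hw hw1 P ht hu hu1 h45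
      linarith
    · linarith
  | false =>
    rw [if_neg Bool.false_ne_true, sub_zero, abs_of_nonneg hu0]
    by_cases h15 : u ≤ 1 / 5
    · have := derandomize_point_light w hw hw1 P ht hu' hu0 h15
      linarith
    · linarith

/-! ### The stub -/

/-- **Derandomized majority vote.** For a probability vector `w` on the edge cube of `K_n` ("restrictions"), Boolean
tests `g ρ`, their average `U(y) = Σ_ρ w(ρ)·𝟙[g ρ y]`, any Boolean `G`, any `0 ≤ p ≤ 1` and any `t ≥ 1`, some `t`
FIXED restrictions `ρs : Fin t → cube` have majority vote `y ↦ [t < 2·#{a : g (ρs a) y}]` within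
`4/t + 5‖U − 𝟙[G]‖_{L¹(G(n,p))}` of `U` in `L¹(G(n,p))` (average over `ρs ∼ w^{⊗t}`, swap the sums, the one-point
bound `derandomize_point` — Chebyshev for the number of accepting votes — and `Σ_y gnpWeight n p y = 1`). [folklore] -/
theorem stub_derandomize :
  ∀ (n t : ℕ), 0 < t → ∀ (p : ℝ), 0 ≤ p → p ≤ 1 →
    ∀ (w : (Edge n → Bool) → ℝ), (∀ ρ, 0 ≤ w ρ) → ∑ ρ, w ρ = 1 →
    ∀ (g : (Edge n → Bool) → (Edge n → Bool) → Bool) (G : (Edge n → Bool) → Bool),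
      ∃ ρs : Fin t → Edge n → Bool,
        l1 n p (ind fun y => decide (t < 2 * #(univ.filter fun a : Fin t => g (ρs a) y = true)))
            (fun y => ∑ ρ, w ρ * ind (g ρ) y) ≤
          4 / t + 5 * l1 n p (fun y => ∑ ρ, w ρ * ind (g ρ) y) (ind G) := by
  intro n t ht p hp0 hp1 w hw hw1 g G
  -- averaging over `ρs ∼ w^{⊗t}`: a minimiser of the `L¹` error is at most the average error
  obtain ⟨ρs, hρs⟩ := derandomize_exists_le_avg (fun ρs : Fin t → Edge n → Bool => ∏ a, w (ρs a))
    (fun ρs => l1 n p (ind fun y => decide (t < 2 * #(univ.filter fun a : Fin t => g (ρs a) y = true)))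
      (fun y => ∑ ρ, w ρ * ind (g ρ) y))
    (fun ρs => prod_nonneg fun a _ => hw (ρs a)) (by rw [← Fintype.sum_pow, hw1, one_pow])
  refine ⟨ρs, hρs.trans ?_⟩
  -- the one-point bound, for every point `y` of the cube
  have hper : ∀ y : Edge n → Bool,
      ∑ ρs : Fin t → Edge n → Bool, (∏ a, w (ρs a)) *
          |ind (fun y => decide (t < 2 * #(univ.filter fun a : Fin t => g (ρs a) y = true))) y -
            ∑ ρ, w ρ * ind (g ρ) y| ≤
        3 / t + 5 * |(∑ ρ, w ρ * ind (g ρ) y) - ind G y| := by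
    intro y
    simpa only [ind] using derandomize_point w hw hw1 (fun ρ => g ρ y) ht (G y)
  -- two bookkeeping identities against `gnpWeight n p` (total mass `1`)
  have h1 : ∑ y : Edge n → Bool, gnpWeight n p y * (3 / (t : ℝ)) = 3 / t := by
    rw [← sum_mul, sum_gnpWeight, one_mul]
  have h2 : ∑ y : Edge n → Bool, gnpWeight n p y * (5 * |(∑ ρ, w ρ * ind (g ρ) y) - ind G y|) =
      5 * l1 n p (fun y => ∑ ρ, w ρ * ind (g ρ) y) (ind G) := by
    simp only [l1, mul_sum]
    exact sum_congr rfl fun y _ => by ring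
  have h34 : (3 : ℝ) / t ≤ 4 / t := div_le_div_of_nonneg_right (by norm_num) (by exact_mod_cast ht.le)
  calc ∑ ρs : Fin t → Edge n → Bool, (∏ a, w (ρs a)) *
        l1 n p (ind fun y => decide (t < 2 * #(univ.filter fun a : Fin t => g (ρs a) y = true)))
          (fun y => ∑ ρ, w ρ * ind (g ρ) y)
      = ∑ y, gnpWeight n p y * ∑ ρs : Fin t → Edge n → Bool, (∏ a, w (ρs a)) *
          |ind (fun y => decide (t < 2 * #(univ.filter fun a : Fin t => g (ρs a) y = true))) y -
            ∑ ρ, w ρ * ind (g ρ) y| := by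
        simp only [l1, mul_sum]
        rw [sum_comm]
        exact sum_congr rfl fun y _ => sum_congr rfl fun ρs _ => by ring
    _ ≤ ∑ y, gnpWeight n p y * (3 / t + 5 * |(∑ ρ, w ρ * ind (g ρ) y) - ind G y|) :=
        sum_le_sum fun y _ => mul_le_mul_of_nonneg_left (hper y) (gnpWeight_nonneg hp0 hp1 y)
    _ = 3 / t + 5 * l1 n p (fun y => ∑ ρ, w ρ * ind (g ρ) y) (ind G) := by
        simp only [mul_add, sum_add_distrib, h1, h2]
    _ ≤ 4 / t + 5 * l1 n p (fun y => ∑ ρ, w ρ * ind (g ρ) y) (ind G) := add_le_add h34 le_rfl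

end

end Summit.PneNP.PneNP.Theorems.MonotoneContinuation
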